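import Summits.BirchSwinnertonDyer.Rank1Residual.X2.DualRestrictionInvariants
import Literature.NumberTheory.EllipticCurves.IwasawaAlgebraProofs
import Literature.NumberTheory.EllipticCurves.IwasawaSelmerDualProofs
import Literature.NumberTheory.EllipticCurves.IwasawaSelmerIsTorsionProofs
import Mathlib.LinearAlgebra.Matrix.Charpoly.LinearMap
import HarnessLib

/-!
# Control bookkeeping in `μ/λ`-currency: `λ` and `μ = 0` along a `Λ`-linear map with `ℤ_p`-finite
# kernel and cokernel (helper file 8 for crux 2 `GoodLatticeBDPValue`, stmt-BirchSwinnertonDyer-19032, cell `bsd-eis` seat `bsd-eis-k5-c2`; planner L17 ADDENDUM (c))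

The last algebraic link of the two-variable road after the descent lemma
(`EisensteinPrimesTwoVariableDescent.descent_iwasawaAlgebra`, p445633): the CONTROL MAP
`φ : 𝔛^{(2)}/(γ₊ − 1) → 𝔛⁻` (ky MEMO-1 R2 (i)–(iii): an isomorphism for `θ|_{G_K} ≠ 𝟙`, injective
with cokernel `Λ/(T) ≅ ℤ_p` for `θ|_{G_K} = 𝟙`) only needs the following GENERIC statement to carry
`μ = 0` and `λ` across (planner RULING L17 ADDENDUM (c), 2026-08-26: "the control-map lemma … in
the same generic style (finite kernel/cokernel under (γ₊ − 1)-coinvariants ⟹ λ unchanged, μ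
unchanged)"):

* `finite_torsion_mu_zero_of_finite_int` : a `Λ`-module finitely generated over `ℤ_p` is
  `Λ`-finite, `Λ`-torsion and has `μ = 0` (exported form of a step of `descent`);
* `control_bookkeeping` : for a `Λ`-linear `φ : X₁ → X₂` with `X₁` and `coker φ` finitely
  generated over `ℤ_p`: `X₂` is finitely generated over `ℤ_p` (hence `Λ`-finite, `Λ`-torsion,
  `μ(X₂) = 0`) and **`λ(X₂) + λ(ker φ) = λ(X₁) + λ(coker φ)`** (`ℚ_p ⊗_{ℤ_p} (·)` is exact);
* `lambdaInvariant_eq_zero_of_finite` : a FINITE `Λ`-module has `λ = 0` — so finite kernel and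
  cokernel leave `λ` unchanged, and a cokernel `Λ/(T) ≅ ℤ_p` adds exactly `1` (the `+[θ|_{G_K} = 𝟙]`
  of `CharMainConjOnTree`).

HONEST FRAMING: generic algebra; closes nothing by itself.  The Galois-cohomological content of the
control (inflation–restriction along `Gal(K̃_∞/K_∞⁻) ≅ ℤ_p`, the everywhere-unramifiedness of
`K̃_∞/K_∞⁻`) is NOT here.  References: Greenberg, LNM 1716 (1999) §1; Washington §13.2.
-/

-- the summit namespace `Summit.BirchSwinnertonDyer.BirchSwinnertonDyer` repeats the problem name by design (D-0017)
set_option linter.dupNamespace false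
set_option autoImplicit false

noncomputable section

open scoped TensorProduct

open Function Literature.NumberTheory.EllipticCurves
  Summit.BirchSwinnertonDyer.Rank1Residual.X2.DualRestrictionInvariants

namespace Summit.BirchSwinnertonDyer.BirchSwinnertonDyer.Theorems.IwasawaTwoVariable

universe u v

section FiniteInt

variable (p : ℕ) [Fact p.Prime] {X : Type u} [AddCommGroup X] [Module (IwasawaAlgebra p) X]
  [Module ℤ_[p] X] [IsScalarTower ℤ_[p] (IwasawaAlgebra p) X]

/-- **A `Λ`-module finitely generated over `ℤ_p` is `Λ`-finite, `Λ`-torsion (Cayley–Hamilton for `T`)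
and has `μ = 0`** (tree `muInvariant_eq_zero_iff_finite`). (Washington §13.2.) [folklore] -/
theorem finite_torsion_mu_zero_of_finite_int [Module.Finite ℤ_[p] X] :
    Module.Finite (IwasawaAlgebra p) X ∧ Module.IsTorsion (IwasawaAlgebra p) X ∧
      muInvariant p X = 0 := by
  have hfin : Module.Finite (IwasawaAlgebra p) X :=
    Module.Finite.of_restrictScalars_finite ℤ_[p] (IwasawaAlgebra p) X
  have htors : Module.IsTorsion (IwasawaAlgebra p) X := by
    obtain ⟨q, hq, hq0⟩ := LinearMap.exists_monic_and_aeval_eq_zero ℤ_[p]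
      (Algebra.lsmul ℤ_[p] ℤ_[p] X (PowerSeries.X : IwasawaAlgebra p))
    have hqX : ∀ x : X, (q : IwasawaAlgebra p) • x = 0 := fun x => by
      have := LinearMap.congr_fun hq0 x
      rwa [Polynomial.aeval_algHom_apply, Polynomial.aeval_def, PowerSeries.algebraMap_eq,
        Polynomial.eval₂_C_X_eq_coe, LinearMap.zero_apply] at this
    have hq' : (q : IwasawaAlgebra p) ≠ 0 := by
      rw [Ne, Polynomial.coe_eq_zero_iff]
      exact hq.ne_zero
    intro x
    exact ⟨⟨q, mem_nonZeroDivisors_of_ne_zero hq'⟩, hqX x⟩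
  haveI := hfin
  exact ⟨hfin, htors, (muInvariant_eq_zero_iff_finite p X htors).2 inferInstance⟩

end FiniteInt

section FiniteLambda

variable (p : ℕ) [Fact p.Prime] {X : Type u} [AddCommGroup X] [Module (IwasawaAlgebra p) X]

/-- **A FINITE `Λ`-module has `λ = 0`**: every element is killed by a power of `p` (its order is
`p^a e` with `e` a unit of `ℤ_p`), so `ℚ_p ⊗_{ℤ_p} X = 0`. [folklore] -/
theorem lambdaInvariant_eq_zero_of_finite [Finite X] : lambdaInvariant p X = 0 := by
  letI : Module ℤ_[p] X := Module.compHom X (algebraMap ℤ_[p] (IwasawaAlgebra p))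
  haveI : IsScalarTower ℤ_[p] (IwasawaAlgebra p) X := IsScalarTower.of_compHom _ _ _
  -- every element is `p`-power torsion
  have htor : ∀ x : X, ∃ n : ℕ, (p : ℤ_[p]) ^ n • x = 0 := by
    intro x
    have hfin : IsOfFinAddOrder x := isOfFinAddOrder_of_finite x
    have hk : addOrderOf x ≠ 0 := hfin.addOrderOf_pos.ne'
    obtain ⟨a, e, he, hde⟩ := Nat.exists_eq_pow_mul_and_not_dvd hk p (Fact.out : p.Prime).ne_one
    obtain ⟨u, hu⟩ := IwasawaDual.isUnit_natCast_padicInt (p := p) he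
    refine ⟨a, ?_⟩
    have h1 : (addOrderOf x) • x = 0 := addOrderOf_nsmul_eq_zero x
    rw [hde, mul_comm, mul_nsmul'] at h1
    -- `e • (p^a • x) = 0` with `e` a unit in `ℤ_p`
    have h2 : ((e : ℤ_[p])) • ((p : ℤ_[p]) ^ a • x) = 0 := by
      rw [Nat.cast_smul_eq_nsmul, ← Nat.cast_pow, Nat.cast_smul_eq_nsmul]
      exact h1
    have h3 : ((u⁻¹ : ℤ_[p]ˣ) : ℤ_[p]) • ((e : ℤ_[p]) • ((p : ℤ_[p]) ^ a • x)) = 0 := by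
      rw [h2, smul_zero]
    rwa [smul_smul, ← hu, Units.inv_mul, one_smul] at h3
  -- hence `ℚ_p ⊗ X = 0`
  change Module.finrank ℚ_[p] (ℚ_[p] ⊗[ℤ_[p]] X) = 0
  haveI : Subsingleton (ℚ_[p] ⊗[ℤ_[p]] X) := by
    refine ⟨fun a b => ?_⟩
    have h0 : ∀ z : ℚ_[p] ⊗[ℤ_[p]] X, z = 0 := fun z => by
      induction z using TensorProduct.induction_on with
      | zero => rfl
      | tmul c x =>
        obtain ⟨n, hn⟩ := htor x
        exact Module.tmul_eq_zero_of_pow_smul_eq_zero ℚ_[p] (isUnit_algebraMap_p p) hn c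
      | add x y hx hy => rw [hx, hy, add_zero]
    rw [h0 a, h0 b]
  exact Module.finrank_zero_of_subsingleton

end FiniteLambda

section Control

variable (p : ℕ) [Fact p.Prime] {X₁ : Type u} {X₂ : Type v}
  [AddCommGroup X₁] [Module (IwasawaAlgebra p) X₁] [Module ℤ_[p] X₁]
  [IsScalarTower ℤ_[p] (IwasawaAlgebra p) X₁]
  [AddCommGroup X₂] [Module (IwasawaAlgebra p) X₂] [Module ℤ_[p] X₂]
  [IsScalarTower ℤ_[p] (IwasawaAlgebra p) X₂]
  (φ : X₁ →ₗ[IwasawaAlgebra p] X₂)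

/-- **Control bookkeeping.**  For a `Λ`-linear map `φ : X₁ → X₂` with `X₁` and `coker φ = X₂/φ(X₁)`
finitely generated over `ℤ_p`: `X₂` is finitely generated over `ℤ_p` — hence `Λ`-finite,
`Λ`-torsion, `μ(X₂) = 0` — and `λ(X₂) + λ(ker φ) = λ(X₁) + λ(coker φ)` (`λ = dim_{ℚ_p} ℚ_p ⊗_{ℤ_p}(·)`
is additive in the two short exact sequences `0 → ker → X₁ → φ(X₁) → 0`,
`0 → φ(X₁) → X₂ → coker → 0`; tree `lambdaInvariant_eq_add_of_surjective`).  With FINITE kernel and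
cokernel (`lambdaInvariant_eq_zero_of_finite`) this is "`λ` unchanged, `μ` unchanged" — the
bookkeeping of the control map `𝔛^{(2)}/(γ₊ − 1) → 𝔛⁻` (ky MEMO-1 R2 (ii)–(iii)). [folklore] -/
theorem control_bookkeeping [Module.Finite ℤ_[p] X₁]
    (hcoker : Module.Finite ℤ_[p] (X₂ ⧸ LinearMap.range φ)) :
    Module.Finite ℤ_[p] X₂ ∧ Module.Finite (IwasawaAlgebra p) X₂ ∧
      Module.IsTorsion (IwasawaAlgebra p) X₂ ∧ muInvariant p X₂ = 0 ∧
      lambdaInvariant p X₂ + lambdaInvariant p (LinearMap.ker φ) =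
        lambdaInvariant p X₁ + lambdaInvariant p (X₂ ⧸ LinearMap.range φ) := by
  -- `φ(X₁)` is finitely generated over `ℤ_p`
  haveI hR : Module.Finite ℤ_[p] (LinearMap.range φ) :=
    Module.Finite.of_surjective (φ.rangeRestrict.restrictScalars ℤ_[p])
      (LinearMap.surjective_rangeRestrict φ)
  -- hence so is `X₂` (extension of finitely generated modules)
  have hX₂ : Module.Finite ℤ_[p] X₂ := by
    refine Module.finite_def.2 (Submodule.fg_of_fg_map_of_fg_inf_ker
      ((LinearMap.range φ).mkQ.restrictScalars ℤ_[p]) ?_ ?_)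
    · have hsurj : Function.Surjective ((LinearMap.range φ).mkQ.restrictScalars ℤ_[p]) := by
        exact Submodule.mkQ_surjective (LinearMap.range φ)
      rw [Submodule.map_top, LinearMap.range_eq_top.2 hsurj]
      exact Module.Finite.fg_top
    · have hker : LinearMap.ker ((LinearMap.range φ).mkQ.restrictScalars ℤ_[p]) =
          LinearMap.range ((LinearMap.range φ).subtype.restrictScalars ℤ_[p]) := by
        ext x
        rw [LinearMap.mem_ker, LinearMap.restrictScalars_apply, Submodule.mkQ_apply,
          Submodule.Quotient.mk_eq_zero, LinearMap.mem_range]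
        constructor
        · intro hx
          exact ⟨⟨x, hx⟩, rfl⟩
        · rintro ⟨y, rfl⟩
          exact y.2
      rw [top_inf_eq, hker, LinearMap.range_eq_map]
      exact Module.Finite.fg_top.map _
  haveI := hX₂
  obtain ⟨hfin₂, htors₂, hmu₂⟩ := finite_torsion_mu_zero_of_finite_int p (X := X₂)
  obtain ⟨hfin₁, htors₁, -⟩ := finite_torsion_mu_zero_of_finite_int p (X := X₁)
  haveI := hfin₁
  haveI := hfin₂
  refine ⟨hX₂, hfin₂, htors₂, hmu₂, ?_⟩
  -- `λ(X₁) = λ(ker φ) + λ(φ(X₁))`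
  have h1 := lambdaInvariant_eq_add_of_surjective p φ.rangeRestrict htors₁
    (LinearMap.surjective_rangeRestrict φ)
  rw [lambdaInvariant_eq_of_linearEquiv
    (LinearEquiv.ofEq _ _ (LinearMap.ker_rangeRestrict φ))] at h1
  -- `λ(X₂) = λ(φ(X₁)) + λ(coker φ)`
  have h2 := lambdaInvariant_eq_add_of_surjective p (LinearMap.range φ).mkQ htors₂
    (Submodule.mkQ_surjective _)
  rw [lambdaInvariant_eq_of_linearEquiv
    (LinearEquiv.ofEq _ _ (Submodule.ker_mkQ (LinearMap.range φ)))] at h2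
  omega

/-- **Finite kernel and cokernel: `λ` unchanged, `μ = 0` preserved.** [folklore] -/
theorem lambdaInvariant_eq_of_finite_ker_coker [Module.Finite ℤ_[p] X₁]
    [Finite (LinearMap.ker φ)] [Finite (X₂ ⧸ LinearMap.range φ)] :
    Module.Finite (IwasawaAlgebra p) X₂ ∧ Module.IsTorsion (IwasawaAlgebra p) X₂ ∧
      muInvariant p X₂ = 0 ∧ lambdaInvariant p X₂ = lambdaInvariant p X₁ := by
  haveI : Module.Finite ℤ_[p] (X₂ ⧸ LinearMap.range φ) := Module.Finite.of_finite
  obtain ⟨-, hfin, htors, hmu, hlam⟩ := control_bookkeeping p φ inferInstance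
  rw [lambdaInvariant_eq_zero_of_finite p (X := LinearMap.ker φ),
    lambdaInvariant_eq_zero_of_finite p (X := X₂ ⧸ LinearMap.range φ)] at hlam
  exact ⟨hfin, htors, hmu, by omega⟩

end Control

end Summit.BirchSwinnertonDyer.BirchSwinnertonDyer.Theorems.IwasawaTwoVariable

end
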